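import Literature.NumberTheory.Automorphic.UnitaryGroupTorusSiegelData
import Literature.NumberTheory.Automorphic.UnitaryGroupTorusSiegelWindows
import Literature.NumberTheory.Automorphic.UnitaryGroupBorelModulusThree
import HarnessLib

/-!
# The height window `H₀ ≤ H(t) ≤ R` of the torus Siegel set of `U(J₃)` is compact; the centre character
# `a_t = d₀⁻¹ d₂` of the torus: compact range on the window and the norm dictionary `‖a_t‖ = ‖d₀‖⁻²`, `χ⁻(a_t) = ‖d₀‖⁻¹ = H(1)/H(t)`
(Rogawski, *Automorphic Representations of Unitary Groups in Three Variables* (1990), §2.2 (p. 13): the `A_t`-part of a Siegel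
set; §7.2, proof of Prop. 7.2.2 (pp. 94–95): the singular Borel term split along the height of `m`, `|α₃(m)|` the module of `m`
on the centre of `N`; Arthur, Duke Math. J. 45 (1978), §8.)

Topic `NumberTheory/Automorphic`; namespace `Literature.NumberTheory.Automorphic.UnitaryGroup`. THEOREMS ONLY over accepted
tree modules (no definition, no named fact, no instance, no notation, no `sorry`). Row (F7) «TORUS SIEGEL WINDOW» of the
(L5-iii-b2) (b2-β) chain «`|b_T| ∈ L¹(Z B_γ(F)∖G(𝔸))` for every `T`» of the T1-qs LAW 5 road of
`Cruxes/H413/Lines/F0_T1InnerFormTraceIdentity.lean` (cell `pub/hodgecm-mathlib`, crux H413; pen word B-p04 (g28) 2026-08-31T13:16:56Z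
(2) + shape request 13:25:00Z): the TORUS half of the middle range, consumed by (F6b) with ★ `TraceZeroCentreLineLatticeSum` §3
(`hL₁` slot) and the LOW ∕ MIDDLE cuts. HC_CM is proved only modulo the printed citations until rung 0 closes.

LETTERS. `E/F` quadratic with involution `c` (`hc : c * c = 1`; `hc1 : c ≠ 1` where a trace-zero idele is needed); the torus
`T(𝔸_F) = torusInBorel F E c 3` of `B(𝔸_F) = borelAdelic F E c 3 ≤ U(J₃)(𝔸_F) = (quasiSplit F E c 3).Adelic`, diagonal entries
`dᵢ t = diagUnit (↑t).2 i ∈ 𝕀_E`, Borel height `H = borelHeight`; the CENTRE CHARACTER `a_t = (d₀ t)⁻¹ * d₂ t` (a `c`-fixed idele, ★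
`conjAdele_torusCentralScalar`; `t` acts on the centre `𝔸_E⁻` of the Heisenberg group through `a_t`) and its module
`χ⁻ = traceZeroModulus`; the torus Siegel set HYPOTHESES-FIRST in the letters of the EXPORT clause of ★ `exists_torusSiegelSet`
(as in ★ `exists_rootWindows_of_export`): closed `S_T ⊆ B(𝔸_F)` (`hSc`), compact `W ⊆ 𝕀_E` (`hW`), torus elements (`hSTt`), and for
`t ∈ S_T` the polar export `d₀ t = w · z(eˢ)` (`w ∈ W`), `d₁ t ∈ W`, `‖d₀ t‖ = e^{[E:ℚ] s}`, `H(t) = ‖d₀ t‖ · H(1)` (`hexp`). THE HEIGHT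
WINDOW is spelled inline: `{t : T(𝔸_F) | ↑t ∈ S_T ∧ H₀ ≤ H(↑↑t) ∧ H(↑↑t) ≤ R}` (`H₀ R : ℝ≥0`, `0 < H₀`).

* §1 **`isCompact_torusSiegel_heightWindow`** — the height window is COMPACT (`H₀ ≤ e^{[E:ℚ]s} H(1) ≤ R` pins `s` to a compact
  interval, so `d₀ t ∈ W · z(e^{[s₀,s₁]})`, `d₁ t ∈ W`: a closed subset of the compact ★ `isCompact_setOf_diagUnit_mem`);
  `isClosed_torusSiegel_heightWindow`, `measure_torusSiegel_heightWindow_lt_top`.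
* §2 **`exists_isCompact_forall_heightWindow_mem`** — a continuous function of `t` has compact range on the window; in particular
  **`exists_isCompact_centralCharacter_inv_mem`** — `∃ L₁ ⊆ 𝔸_E` compact with `↑(a_t⁻¹) ∈ L₁` on the window (the `hL₁` slot of ★
  `exists_nat_norm_tsum_centreLine_le`).
* §3 THE NORM DICTIONARY on all of `T(𝔸_F)` (torus relations + Galois invariance of `‖·‖`, ★ `distribHaarChar_torus_three`, ★
  `AdeleRing.distribHaarChar_eq_ideleNorm`): `ideleNorm_diagUnit_one_torus` (`‖d₁‖ = 1`), `ideleNorm_diagUnit_two_torus`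
  (`‖d₂‖ = ‖d₀‖⁻¹`), **`ideleNorm_centralCharacter_torus`** (`‖a_t‖ = (‖d₀‖⁻¹)²`), **`traceZeroModulus_centralCharacter_torus`**
  (`χ⁻(a_t) = ‖d₀‖⁻¹`, ★ `traceZeroModulus_eq_sqrt`).
* §4 THE HEIGHT DICTIONARY: `borelHeight_torus_coe_eq` (`H(t) = ‖d₀ t‖ · H(1)`), **`traceZeroModulus_centralCharacter_mul_borelHeight`**
  (`χ⁻(a_t) · H(t) = H(1)`), `ideleNorm_centralCharacter_mul_borelHeight_sq` (`‖a_t‖ · H(t)² = H(1)²`) — the `χ⁻ ↔ H` conversion.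
* §5 the same in the pen's letters `t ∈ S_T ⊆ B(𝔸_F)`, `torusPart t = t`, window quantified first (`…_of_export`, `…_of_torusPart_eq`).

## References

* J. D. Rogawski, *Automorphic Representations of Unitary Groups in Three Variables*, Ann. of Math. Stud. 123 (1990), §1.10,
  §2.2 (p. 13), §7.2 Prop. 7.2.2 (pp. 94–95) [Rogawski1990].
* J. Arthur, *A trace formula for reductive groups I*, Duke Math. J. 45 (1978), §8 [Arthur1978TraceFormulaI].
* A. Borel, *Some finiteness properties of adele groups over number fields*, Publ. Math. IHÉS 16 (1963), §5 [Borel1963].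
* J. Tate, *Fourier analysis in number fields and Hecke's zeta-functions* (1967), Lemma 4.1.2 [TateThesis1967].
-/

set_option autoImplicit false

noncomputable section

open MeasureTheory Measure NumberField IsDedekindDomain Set Topology
open scoped NNReal ENNReal Pointwise

namespace Literature.NumberTheory.Automorphic

namespace UnitaryGroup

variable {F E : Type} [Field F] [NumberField F] [Field E] [NumberField E] [Algebra F E] {c : E ≃ₐ[F] E}

/-! ## §1 The height window of the torus Siegel set is compact -/

section Window

/-- **The height window is closed**: `{t ∈ T(𝔸_F) | ↑t ∈ S_T, H₀ ≤ H(t) ≤ R}` is closed for a closed `S_T` (`H` is continuous, ★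
`continuous_borelHeight`). [cite: Rogawski1990, §2.2 (p. 13)] -/
theorem isClosed_torusSiegel_heightWindow {S_T : Set (borelAdelic F E c 3)} (hSc : IsClosed S_T) (H₀ R : ℝ≥0) :
    IsClosed {t : torusInBorel F E c 3 | (t : borelAdelic F E c 3) ∈ S_T ∧
      H₀ ≤ borelHeight ((t : borelAdelic F E c 3) : (quasiSplit F E c 3).Adelic) ∧
      borelHeight ((t : borelAdelic F E c 3) : (quasiSplit F E c 3).Adelic) ≤ R} := by
  have hH : Continuous fun t : torusInBorel F E c 3 =>
      borelHeight ((t : borelAdelic F E c 3) : (quasiSplit F E c 3).Adelic) :=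
    continuous_borelHeight.comp (continuous_subtype_val.comp continuous_subtype_val)
  rw [Set.setOf_and, Set.setOf_and]
  exact (hSc.preimage continuous_subtype_val).inter
    ((isClosed_le continuous_const hH).inter (isClosed_le hH continuous_const))

/-- **THE HEIGHT WINDOW OF THE TORUS SIEGEL SET IS COMPACT.** Under the polar export of ★ `exists_torusSiegelSet` (`d₀ t = w · z(eˢ)`,
`w, d₁ t ∈ W` compact, `‖d₀ t‖ = e^{[E:ℚ]s}`, `H(t) = ‖d₀ t‖ · H(1)`) and for `0 < H₀`: the set `{t ∈ T(𝔸_F) | ↑t ∈ S_T, H₀ ≤ H(t) ≤ R}`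
is compact — `H₀ ≤ e^{[E:ℚ]s} H(1) ≤ R` confines `s` to `[log(H₀/H(1))/[E:ℚ], log(R/H(1))/[E:ℚ]]`, so `d₀ t ∈ W · z(e^{[s₀,s₁]})` and
`d₁ t ∈ W` (compact windows of `𝕀_E`): a closed subset of the compact ★ `isCompact_setOf_diagUnit_mem`. The `A_t`-part of a Siegel set
between two heights is relatively compact (Rogawski §2.2; Borel §5). [cite: Rogawski1990, §2.2 (p. 13)] [cite: Borel1963, §5] -/
theorem isCompact_torusSiegel_heightWindow (hc : c * c = 1) {S_T : Set (borelAdelic F E c 3)}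
    {W : Set (AdeleRing (𝓞 E) E)ˣ} (hSc : IsClosed S_T) (hW : IsCompact W)
    (hexp : ∀ t ∈ S_T, ∃ w ∈ W, ∃ s : ℝ,
      diagUnit t.2 0 = w * posRealIdele E (expUnitNNReal s) ∧ diagUnit t.2 1 ∈ W ∧
      IdeleClassGroup.ideleNorm E (diagUnit t.2 0) = ((expUnitNNReal (Module.finrank ℚ E * s) : ℝ≥0ˣ) : ℝ≥0) ∧
      borelHeight (t : (quasiSplit F E c 3).Adelic) =
        IdeleClassGroup.ideleNorm E (diagUnit t.2 0) * borelHeight (1 : (quasiSplit F E c 3).Adelic))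
    {H₀ : ℝ≥0} (hH₀ : 0 < H₀) (R : ℝ≥0) :
    IsCompact {t : torusInBorel F E c 3 | (t : borelAdelic F E c 3) ∈ S_T ∧
      H₀ ≤ borelHeight ((t : borelAdelic F E c 3) : (quasiSplit F E c 3).Adelic) ∧
      borelHeight ((t : borelAdelic F E c 3) : (quasiSplit F E c 3).Adelic) ≤ R} := by
  -- constants: `n = [E:ℚ] > 0`, `H₁ = H(1) > 0`, the `s`-interval `[s₀, s₁]`
  set n : ℝ := (Module.finrank ℚ E : ℝ) with hn
  have hn0 : 0 < n := by
    rw [hn]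
    exact_mod_cast Module.finrank_pos
  set H₁ : ℝ := ((borelHeight (1 : (quasiSplit F E c 3).Adelic) : ℝ≥0) : ℝ) with hH₁
  have hH₁0 : 0 < H₁ := by
    rw [hH₁]
    exact_mod_cast borelHeight_pos (1 : (quasiSplit F E c 3).Adelic)
  have hH₀0 : 0 < ((H₀ : ℝ≥0) : ℝ) := by exact_mod_cast hH₀
  set s₀ : ℝ := Real.log ((H₀ : ℝ) / H₁) / n with hs₀
  set s₁ : ℝ := Real.log ((R : ℝ) / H₁) / n with hs₁
  -- the compact windows of `𝕀_E`
  set Ray : Set (AdeleRing (𝓞 E) E)ˣ := (fun s : ℝ => posRealIdele E (expUnitNNReal s)) '' Icc s₀ s₁ with hRay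
  have hRayc : IsCompact Ray := isCompact_Icc.image ((continuous_posRealIdele E).comp continuous_expUnitNNReal)
  have hK := isCompact_setOf_diagUnit_mem (F := F) (E := E) (c := c) hc (hW.mul hRayc) hW
  refine hK.of_isClosed_subset (isClosed_torusSiegel_heightWindow hSc H₀ R) ?_
  rintro t ⟨ht, hlow, hup⟩
  obtain ⟨w, hwW, s, hd0, hd1, hnorm, hHt⟩ := hexp (t : borelAdelic F E c 3) ht
  -- the height of `t` as a real number: `H(t) = e^{n s} · H₁`
  have hHreal : ((borelHeight ((t : borelAdelic F E c 3) : (quasiSplit F E c 3).Adelic) : ℝ≥0) : ℝ) =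
      Real.exp (n * s) * H₁ := by
    rw [hHt, hnorm, NNReal.coe_mul, coe_expUnitNNReal]
  have hlow' : ((H₀ : ℝ≥0) : ℝ) ≤ Real.exp (n * s) * H₁ := by
    rw [← hHreal]; exact_mod_cast hlow
  have hup' : Real.exp (n * s) * H₁ ≤ ((R : ℝ≥0) : ℝ) := by
    rw [← hHreal]; exact_mod_cast hup
  -- hence `s ∈ [s₀, s₁]`
  have hs : s ∈ Icc s₀ s₁ := by
    constructor
    · -- `log (H₀/H₁) ≤ n s`
      have h1 : (H₀ : ℝ) / H₁ ≤ Real.exp (n * s) := (div_le_iff₀ hH₁0).2 hlow'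
      have h2 : Real.log ((H₀ : ℝ) / H₁) ≤ n * s :=
        (Real.log_le_iff_le_exp (div_pos hH₀0 hH₁0)).2 h1
      rw [hs₀]
      exact (div_le_iff₀' hn0).2 h2
    · -- `n s ≤ log (R/H₁)`
      have hR0 : 0 < ((R : ℝ≥0) : ℝ) := lt_of_lt_of_le (mul_pos (Real.exp_pos _) hH₁0) hup'
      have h1 : Real.exp (n * s) ≤ (R : ℝ) / H₁ := (le_div_iff₀ hH₁0).2 hup'
      have h2 : n * s ≤ Real.log ((R : ℝ) / H₁) :=
        (Real.le_log_iff_exp_le (div_pos hR0 hH₁0)).2 h1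
      rw [hs₁]
      exact (le_div_iff₀' hn0).2 h2
  refine ⟨?_, hd1⟩
  rw [hd0]
  exact Set.mul_mem_mul hwW ⟨s, hs, rfl⟩


/-- **The height window has finite measure** for every measure on `T(𝔸_F)` finite on compacts (e.g. a Haar measure `μ_T`).
[cite: Rogawski1990, §2.2 (p. 13)] [cite: Arthur1978TraceFormulaI, §8 (pp. 947–950)] -/
theorem measure_torusSiegel_heightWindow_lt_top (hc : c * c = 1) [MeasurableSpace (torusInBorel F E c 3)]
    (μT : Measure (torusInBorel F E c 3)) [IsFiniteMeasureOnCompacts μT] {S_T : Set (borelAdelic F E c 3)}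
    {W : Set (AdeleRing (𝓞 E) E)ˣ} (hSc : IsClosed S_T) (hW : IsCompact W)
    (hexp : ∀ t ∈ S_T, ∃ w ∈ W, ∃ s : ℝ,
      diagUnit t.2 0 = w * posRealIdele E (expUnitNNReal s) ∧ diagUnit t.2 1 ∈ W ∧
      IdeleClassGroup.ideleNorm E (diagUnit t.2 0) = ((expUnitNNReal (Module.finrank ℚ E * s) : ℝ≥0ˣ) : ℝ≥0) ∧
      borelHeight (t : (quasiSplit F E c 3).Adelic) =
        IdeleClassGroup.ideleNorm E (diagUnit t.2 0) * borelHeight (1 : (quasiSplit F E c 3).Adelic))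
    {H₀ : ℝ≥0} (hH₀ : 0 < H₀) (R : ℝ≥0) :
    μT {t : torusInBorel F E c 3 | (t : borelAdelic F E c 3) ∈ S_T ∧
      H₀ ≤ borelHeight ((t : borelAdelic F E c 3) : (quasiSplit F E c 3).Adelic) ∧
      borelHeight ((t : borelAdelic F E c 3) : (quasiSplit F E c 3).Adelic) ≤ R} < ∞ :=
  (isCompact_torusSiegel_heightWindow hc hSc hW hexp hH₀ R).measure_lt_top

end Window

/-! ## §2 Compact ranges on the window: the centre character `a_t = d₀⁻¹ d₂` -/

section Ranges

/-- **Every continuous function of `t` has compact range on the height window** (continuous image of the compact window).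
[cite: Rogawski1990, §2.2 (p. 13)] -/
theorem exists_isCompact_forall_heightWindow_mem (hc : c * c = 1) {S_T : Set (borelAdelic F E c 3)}
    {W : Set (AdeleRing (𝓞 E) E)ˣ} (hSc : IsClosed S_T) (hW : IsCompact W)
    (hexp : ∀ t ∈ S_T, ∃ w ∈ W, ∃ s : ℝ,
      diagUnit t.2 0 = w * posRealIdele E (expUnitNNReal s) ∧ diagUnit t.2 1 ∈ W ∧
      IdeleClassGroup.ideleNorm E (diagUnit t.2 0) = ((expUnitNNReal (Module.finrank ℚ E * s) : ℝ≥0ˣ) : ℝ≥0) ∧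
      borelHeight (t : (quasiSplit F E c 3).Adelic) =
        IdeleClassGroup.ideleNorm E (diagUnit t.2 0) * borelHeight (1 : (quasiSplit F E c 3).Adelic))
    {H₀ : ℝ≥0} (hH₀ : 0 < H₀) (R : ℝ≥0) {Y : Type*} [TopologicalSpace Y] {φ : torusInBorel F E c 3 → Y}
    (hφ : Continuous φ) :
    ∃ L : Set Y, IsCompact L ∧ ∀ t : torusInBorel F E c 3, (t : borelAdelic F E c 3) ∈ S_T →
      H₀ ≤ borelHeight ((t : borelAdelic F E c 3) : (quasiSplit F E c 3).Adelic) →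
      borelHeight ((t : borelAdelic F E c 3) : (quasiSplit F E c 3).Adelic) ≤ R → φ t ∈ L :=
  ⟨φ '' {t : torusInBorel F E c 3 | (t : borelAdelic F E c 3) ∈ S_T ∧
      H₀ ≤ borelHeight ((t : borelAdelic F E c 3) : (quasiSplit F E c 3).Adelic) ∧
      borelHeight ((t : borelAdelic F E c 3) : (quasiSplit F E c 3).Adelic) ≤ R},
    (isCompact_torusSiegel_heightWindow hc hSc hW hexp hH₀ R).image hφ,
    fun _ ht hlow hup => Set.mem_image_of_mem φ ⟨ht, hlow, hup⟩⟩

/-- `t ↦ a_t = (d₀ t)⁻¹ * d₂ t` is continuous on `T(𝔸_F)` (★ `continuous_diagUnit_torus`). [cite: Rogawski1990, §1.10] -/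
theorem continuous_centralCharacter_torus :
    Continuous fun t : torusInBorel F E c 3 =>
      ((diagUnit (t : borelAdelic F E c 3).2 0)⁻¹ * diagUnit (t : borelAdelic F E c 3).2 2 : (AdeleRing (𝓞 E) E)ˣ) :=
  (continuous_diagUnit_torus 0).inv.mul (continuous_diagUnit_torus 2)

/-- **`hL₁` OF THE MIDDLE LATTICE BOUND**: there is a compact `L₁ ⊆ 𝔸_E` with `↑(a_t⁻¹) ∈ L₁` for every `t` in the height window
(`a_t = (d₀ t)⁻¹ * d₂ t`; the slot `((l⁻¹ : 𝕀_E) : 𝔸_E) ∈ L₁` of ★ `exists_nat_norm_tsum_centreLine_le` at `l := a_t`).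
[cite: Rogawski1990, §7.2 Prop. 7.2.2 (pp. 94–95)] -/
theorem exists_isCompact_centralCharacter_inv_mem (hc : c * c = 1) {S_T : Set (borelAdelic F E c 3)}
    {W : Set (AdeleRing (𝓞 E) E)ˣ} (hSc : IsClosed S_T) (hW : IsCompact W)
    (hexp : ∀ t ∈ S_T, ∃ w ∈ W, ∃ s : ℝ,
      diagUnit t.2 0 = w * posRealIdele E (expUnitNNReal s) ∧ diagUnit t.2 1 ∈ W ∧
      IdeleClassGroup.ideleNorm E (diagUnit t.2 0) = ((expUnitNNReal (Module.finrank ℚ E * s) : ℝ≥0ˣ) : ℝ≥0) ∧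
      borelHeight (t : (quasiSplit F E c 3).Adelic) =
        IdeleClassGroup.ideleNorm E (diagUnit t.2 0) * borelHeight (1 : (quasiSplit F E c 3).Adelic))
    {H₀ : ℝ≥0} (hH₀ : 0 < H₀) (R : ℝ≥0) :
    ∃ L₁ : Set (AdeleRing (𝓞 E) E), IsCompact L₁ ∧ ∀ t : torusInBorel F E c 3, (t : borelAdelic F E c 3) ∈ S_T →
      H₀ ≤ borelHeight ((t : borelAdelic F E c 3) : (quasiSplit F E c 3).Adelic) →
      borelHeight ((t : borelAdelic F E c 3) : (quasiSplit F E c 3).Adelic) ≤ R →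
      ((((diagUnit (t : borelAdelic F E c 3).2 0)⁻¹ * diagUnit (t : borelAdelic F E c 3).2 2)⁻¹ : (AdeleRing (𝓞 E) E)ˣ) :
        AdeleRing (𝓞 E) E) ∈ L₁ :=
  exists_isCompact_forall_heightWindow_mem hc hSc hW hexp hH₀ R
    (Units.continuous_val.comp continuous_centralCharacter_torus.inv)


end Ranges

/-! ## §3 The norm dictionary of the torus: `‖d₁‖ = 1`, `‖d₂‖ = ‖d₀‖⁻¹`, `‖a_t‖ = ‖d₀‖⁻²`, `χ⁻(a_t) = ‖d₀‖⁻¹` -/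

section Norms

variable [LocallyCompactSpace (AdeleRing (𝓞 E) E)]

/-- **`‖d₁ t‖ = 1` on `T(𝔸_F)`** (torus relation `c(d₁) d₁ = 1` and `‖c(x)‖ = ‖x‖`; ★ `distribHaarChar_torus_three` read through ★
`AdeleRing.distribHaarChar_eq_ideleNorm`). [cite: Rogawski1990, §2.2 (p. 13)] [cite: TateThesis1967, Lemma 4.1.2] -/
theorem ideleNorm_diagUnit_one_torus (t : torusInBorel F E c 3) :
    IdeleClassGroup.ideleNorm E (diagUnit (t : borelAdelic F E c 3).2 1) = 1 := by
  have h := (distribHaarChar_torus_three t (adelicVal_torus_eq_glDiagonal_diagUnit t).symm).1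
  rwa [AdeleRing.distribHaarChar_eq_ideleNorm] at h

/-- **`‖d₂ t‖ = ‖d₀ t‖⁻¹` on `T(𝔸_F)`** (torus relation `c(d₀) d₂ = 1`). [cite: Rogawski1990, §2.2 (p. 13)] [cite: TateThesis1967, Lemma 4.1.2] -/
theorem ideleNorm_diagUnit_two_torus (t : torusInBorel F E c 3) :
    IdeleClassGroup.ideleNorm E (diagUnit (t : borelAdelic F E c 3).2 2) =
      (IdeleClassGroup.ideleNorm E (diagUnit (t : borelAdelic F E c 3).2 0))⁻¹ := by
  have h := (distribHaarChar_torus_three t (adelicVal_torus_eq_glDiagonal_diagUnit t).symm).2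
  rwa [AdeleRing.distribHaarChar_eq_ideleNorm, AdeleRing.distribHaarChar_eq_ideleNorm] at h

/-- **`‖a_t‖ = (‖d₀ t‖⁻¹)²`** for the centre character `a_t = (d₀ t)⁻¹ * d₂ t` of a torus element (Rogawski's `|α₃(m)|` against
`δ_B(m) = ‖d₀‖²`). [cite: Rogawski1990, §2.2 (p. 13)] [cite: Rogawski1990, §7.2 Prop. 7.2.2 (pp. 94–95)] -/
theorem ideleNorm_centralCharacter_torus (t : torusInBorel F E c 3) :
    IdeleClassGroup.ideleNorm E
        ((diagUnit (t : borelAdelic F E c 3).2 0)⁻¹ * diagUnit (t : borelAdelic F E c 3).2 2 : (AdeleRing (𝓞 E) E)ˣ) =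
      (IdeleClassGroup.ideleNorm E (diagUnit (t : borelAdelic F E c 3).2 0))⁻¹ ^ 2 := by
  rw [map_mul, map_inv, ideleNorm_diagUnit_two_torus t, sq]

/-- **`χ⁻(a_t) = ‖d₀ t‖⁻¹`**: the module of the centre character `a_t = (d₀ t)⁻¹ * d₂ t` on the trace-zero adeles `𝔸_E⁻` is
`‖d₀ t‖⁻¹` (`χ⁻ = ‖·‖^{1/2}`, ★ `traceZeroModulus_eq_sqrt`, needs `c ≠ 1` for a trace-zero idele; any proof `hl` of the
`c`-fixedness of `a_t`, e.g. ★ `conjAdele_torusCentralScalar`). Rogawski's `|α₃(m)|⁻¹ = ` the first diagonal module.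
[cite: Rogawski1990, §7.2 Prop. 7.2.2 (pp. 94–95)] [cite: Rogawski1990, §2.2 (p. 13)] -/
theorem traceZeroModulus_centralCharacter_torus (hc : c * c = 1) (hc1 : c ≠ 1) [MeasurableSpace (AdeleRing (𝓞 E) E)]
    [BorelSpace (AdeleRing (𝓞 E) E)] (t : torusInBorel F E c 3)
    (hl : conjAdele F E c
      ((((diagUnit (t : borelAdelic F E c 3).2 0)⁻¹ * diagUnit (t : borelAdelic F E c 3).2 2 : (AdeleRing (𝓞 E) E)ˣ)) :
        AdeleRing (𝓞 E) E) =
      ((diagUnit (t : borelAdelic F E c 3).2 0)⁻¹ * diagUnit (t : borelAdelic F E c 3).2 2 : (AdeleRing (𝓞 E) E)ˣ)) :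
    traceZeroModulus ((diagUnit (t : borelAdelic F E c 3).2 0)⁻¹ * diagUnit (t : borelAdelic F E c 3).2 2) hl =
      (IdeleClassGroup.ideleNorm E (diagUnit (t : borelAdelic F E c 3).2 0))⁻¹ := by
  obtain ⟨δ, hδ⟩ := exists_conjAdele_eq_neg (F := F) (E := E) (c := c) hc hc1
  rw [traceZeroModulus_eq_sqrt hc δ hδ _ hl, AdeleRing.distribHaarChar_eq_ideleNorm, ideleNorm_centralCharacter_torus t,
    NNReal.sqrt_sq]


end Norms

/-! ## §4 The height dictionary: `H(t) = ‖d₀ t‖ · H(1)`, `χ⁻(a_t) · H(t) = H(1)`, `‖a_t‖ · H(t)² = H(1)²` -/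

section Height

/-- **`H(t) = ‖d₀ t‖ · H(1)` on `T(𝔸_F)`** (★ `borelHeight_torus_mul'` at `g = 1`). [cite: Rogawski1990, §2.2 (p. 13)] -/
theorem borelHeight_torus_coe_eq (t : torusInBorel F E c 3) :
    borelHeight ((t : borelAdelic F E c 3) : (quasiSplit F E c 3).Adelic) =
      IdeleClassGroup.ideleNorm E (diagUnit (t : borelAdelic F E c 3).2 0) * borelHeight (1 : (quasiSplit F E c 3).Adelic) := by
  have h := borelHeight_torus_mul' (adelicVal_torus_eq_glDiagonal_diagUnit t).symm (1 : (quasiSplit F E c 3).Adelic)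
  rwa [mul_one] at h


variable [LocallyCompactSpace (AdeleRing (𝓞 E) E)]

/-- **`χ⁻(a_t) · H(t) = H(1)`**: the module of the centre character against the Borel height — the `χ⁻ ↔ H` conversion of the
LOW ∕ MIDDLE cuts of the singular Borel term (`|α₃(m)|⁻¹` against `H(m)`). [cite: Rogawski1990, §7.2 Prop. 7.2.2 (pp. 94–95)] -/
theorem traceZeroModulus_centralCharacter_mul_borelHeight (hc : c * c = 1) (hc1 : c ≠ 1)
    [MeasurableSpace (AdeleRing (𝓞 E) E)] [BorelSpace (AdeleRing (𝓞 E) E)] (t : torusInBorel F E c 3)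
    (hl : conjAdele F E c
      ((((diagUnit (t : borelAdelic F E c 3).2 0)⁻¹ * diagUnit (t : borelAdelic F E c 3).2 2 : (AdeleRing (𝓞 E) E)ˣ)) :
        AdeleRing (𝓞 E) E) =
      ((diagUnit (t : borelAdelic F E c 3).2 0)⁻¹ * diagUnit (t : borelAdelic F E c 3).2 2 : (AdeleRing (𝓞 E) E)ˣ)) :
    traceZeroModulus ((diagUnit (t : borelAdelic F E c 3).2 0)⁻¹ * diagUnit (t : borelAdelic F E c 3).2 2) hl *
        borelHeight ((t : borelAdelic F E c 3) : (quasiSplit F E c 3).Adelic) =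
      borelHeight (1 : (quasiSplit F E c 3).Adelic) := by
  have h0 : IdeleClassGroup.ideleNorm E (diagUnit (t : borelAdelic F E c 3).2 0) ≠ 0 := by
    intro h
    have := borelHeight_torus_coe_eq t
    rw [h, zero_mul] at this
    exact (borelHeight_pos _).ne' this
  rw [traceZeroModulus_centralCharacter_torus hc hc1 t hl, borelHeight_torus_coe_eq t, ← mul_assoc, inv_mul_cancel₀ h0,
    one_mul]


/-- **`‖a_t‖ · H(t)² = H(1)²`** (the idelic norm of the centre character against the height). [cite: Rogawski1990, §7.2 Prop. 7.2.2 (pp. 94–95)] -/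
theorem ideleNorm_centralCharacter_mul_borelHeight_sq (t : torusInBorel F E c 3) :
    IdeleClassGroup.ideleNorm E
          ((diagUnit (t : borelAdelic F E c 3).2 0)⁻¹ * diagUnit (t : borelAdelic F E c 3).2 2 : (AdeleRing (𝓞 E) E)ˣ) *
        borelHeight ((t : borelAdelic F E c 3) : (quasiSplit F E c 3).Adelic) ^ 2 =
      borelHeight (1 : (quasiSplit F E c 3).Adelic) ^ 2 := by
  have h0 : IdeleClassGroup.ideleNorm E (diagUnit (t : borelAdelic F E c 3).2 0) ≠ 0 := by
    intro h
    have := borelHeight_torus_coe_eq t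
    rw [h, zero_mul] at this
    exact (borelHeight_pos _).ne' this
  rw [ideleNorm_centralCharacter_torus t, borelHeight_torus_coe_eq t, mul_pow, ← mul_assoc, ← mul_pow,
    inv_mul_cancel₀ h0, one_pow, one_mul]


end Height

/-! ## §5 The same in the letters of `S_T ⊆ B(𝔸_F)`: `t : borelAdelic F E c 3` with `torusPart t = t` -/

section BorelLetters

/-- **`hL₁` in the pen's letters** (window quantified first, `t ∈ S_T ⊆ B(𝔸_F)`): for `0 < H₀` and any `R` there is a compact
`L₁ ⊆ 𝔸_E` with `↑(a_t⁻¹) ∈ L₁` for every `t ∈ S_T` with `H₀ ≤ H(t) ≤ R` (`a_t = (d₀ t)⁻¹ * d₂ t`, `dᵢ t = diagUnit t.2 i`; `hSTt` lifts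
`t` to `T(𝔸_F)`). [cite: Rogawski1990, §7.2 Prop. 7.2.2 (pp. 94–95)] -/
theorem exists_isCompact_centralCharacter_inv_mem_of_export (hc : c * c = 1) {S_T : Set (borelAdelic F E c 3)}
    {W : Set (AdeleRing (𝓞 E) E)ˣ} (hSc : IsClosed S_T) (hW : IsCompact W) (hSTt : ∀ t ∈ S_T, torusPart t = t)
    (hexp : ∀ t ∈ S_T, ∃ w ∈ W, ∃ s : ℝ,
      diagUnit t.2 0 = w * posRealIdele E (expUnitNNReal s) ∧ diagUnit t.2 1 ∈ W ∧
      IdeleClassGroup.ideleNorm E (diagUnit t.2 0) = ((expUnitNNReal (Module.finrank ℚ E * s) : ℝ≥0ˣ) : ℝ≥0) ∧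
      borelHeight (t : (quasiSplit F E c 3).Adelic) =
        IdeleClassGroup.ideleNorm E (diagUnit t.2 0) * borelHeight (1 : (quasiSplit F E c 3).Adelic))
    {H₀ : ℝ≥0} (hH₀ : 0 < H₀) (R : ℝ≥0) :
    ∃ L₁ : Set (AdeleRing (𝓞 E) E), IsCompact L₁ ∧ ∀ t ∈ S_T,
      H₀ ≤ borelHeight (t : (quasiSplit F E c 3).Adelic) → borelHeight (t : (quasiSplit F E c 3).Adelic) ≤ R →
      ((((diagUnit t.2 0)⁻¹ * diagUnit t.2 2)⁻¹ : (AdeleRing (𝓞 E) E)ˣ) : AdeleRing (𝓞 E) E) ∈ L₁ := by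
  obtain ⟨L₁, hL₁, h⟩ := exists_isCompact_centralCharacter_inv_mem hc hSc hW hexp hH₀ R
  exact ⟨L₁, hL₁, fun t ht hlow hup => h ⟨t, (mem_torusInBorel_iff_torusPart_eq t).2 (hSTt t ht)⟩ ht hlow hup⟩

/-- Likewise a compact `L ⊆ 𝔸_E` with `↑a_t ∈ L` for `t ∈ S_T`, `H₀ ≤ H(t) ≤ R`. [cite: Rogawski1990, §7.2 Prop. 7.2.2 (pp. 94–95)] -/
theorem exists_isCompact_centralCharacter_mem_of_export (hc : c * c = 1) {S_T : Set (borelAdelic F E c 3)}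
    {W : Set (AdeleRing (𝓞 E) E)ˣ} (hSc : IsClosed S_T) (hW : IsCompact W) (hSTt : ∀ t ∈ S_T, torusPart t = t)
    (hexp : ∀ t ∈ S_T, ∃ w ∈ W, ∃ s : ℝ,
      diagUnit t.2 0 = w * posRealIdele E (expUnitNNReal s) ∧ diagUnit t.2 1 ∈ W ∧
      IdeleClassGroup.ideleNorm E (diagUnit t.2 0) = ((expUnitNNReal (Module.finrank ℚ E * s) : ℝ≥0ˣ) : ℝ≥0) ∧
      borelHeight (t : (quasiSplit F E c 3).Adelic) =
        IdeleClassGroup.ideleNorm E (diagUnit t.2 0) * borelHeight (1 : (quasiSplit F E c 3).Adelic))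
    {H₀ : ℝ≥0} (hH₀ : 0 < H₀) (R : ℝ≥0) :
    ∃ L : Set (AdeleRing (𝓞 E) E), IsCompact L ∧ ∀ t ∈ S_T,
      H₀ ≤ borelHeight (t : (quasiSplit F E c 3).Adelic) → borelHeight (t : (quasiSplit F E c 3).Adelic) ≤ R →
      ((((diagUnit t.2 0)⁻¹ * diagUnit t.2 2) : (AdeleRing (𝓞 E) E)ˣ) : AdeleRing (𝓞 E) E) ∈ L := by
  obtain ⟨L, hL, h⟩ := exists_isCompact_forall_heightWindow_mem hc hSc hW hexp hH₀ R
    (Units.continuous_val.comp continuous_centralCharacter_torus)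
  exact ⟨L, hL, fun t ht hlow hup => h ⟨t, (mem_torusInBorel_iff_torusPart_eq t).2 (hSTt t ht)⟩ ht hlow hup⟩


variable [LocallyCompactSpace (AdeleRing (𝓞 E) E)]

/-- **`‖a_t‖ = (‖d₀ t‖⁻¹)²` for every `t ∈ B(𝔸_F)` with `torusPart t = t`** (no Siegel hypothesis).
[cite: Rogawski1990, §2.2 (p. 13)] [cite: Rogawski1990, §7.2 Prop. 7.2.2 (pp. 94–95)] -/
theorem ideleNorm_centralCharacter_of_torusPart_eq {t : borelAdelic F E c 3} (ht : torusPart t = t) :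
    IdeleClassGroup.ideleNorm E ((diagUnit t.2 0)⁻¹ * diagUnit t.2 2 : (AdeleRing (𝓞 E) E)ˣ) =
      (IdeleClassGroup.ideleNorm E (diagUnit t.2 0))⁻¹ ^ 2 :=
  ideleNorm_centralCharacter_torus ⟨t, (mem_torusInBorel_iff_torusPart_eq t).2 ht⟩


/-- **`χ⁻(a_t) = ‖d₀ t‖⁻¹` for every `t ∈ B(𝔸_F)` with `torusPart t = t`** (any proof `hl` of the `c`-fixedness of `a_t`, e.g. ★
`conjAdele_torusCentralScalar` at the torus element `⟨t, _⟩`). [cite: Rogawski1990, §7.2 Prop. 7.2.2 (pp. 94–95)] -/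
theorem traceZeroModulus_centralCharacter_of_torusPart_eq (hc : c * c = 1) (hc1 : c ≠ 1)
    [MeasurableSpace (AdeleRing (𝓞 E) E)] [BorelSpace (AdeleRing (𝓞 E) E)] {t : borelAdelic F E c 3} (ht : torusPart t = t)
    (hl : conjAdele F E c ((((diagUnit t.2 0)⁻¹ * diagUnit t.2 2 : (AdeleRing (𝓞 E) E)ˣ)) : AdeleRing (𝓞 E) E) =
      ((diagUnit t.2 0)⁻¹ * diagUnit t.2 2 : (AdeleRing (𝓞 E) E)ˣ)) :
    traceZeroModulus ((diagUnit t.2 0)⁻¹ * diagUnit t.2 2) hl = (IdeleClassGroup.ideleNorm E (diagUnit t.2 0))⁻¹ :=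
  traceZeroModulus_centralCharacter_torus hc hc1 ⟨t, (mem_torusInBorel_iff_torusPart_eq t).2 ht⟩ hl

omit [LocallyCompactSpace (AdeleRing (𝓞 E) E)] in
/-- `H(t) = ‖d₀ t‖ · H(1)` for `torusPart t = t`. [cite: Rogawski1990, §2.2 (p. 13)] -/
theorem borelHeight_eq_ideleNorm_mul_of_torusPart_eq {t : borelAdelic F E c 3} (ht : torusPart t = t) :
    borelHeight (t : (quasiSplit F E c 3).Adelic) =
      IdeleClassGroup.ideleNorm E (diagUnit t.2 0) * borelHeight (1 : (quasiSplit F E c 3).Adelic) :=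
  borelHeight_torus_coe_eq ⟨t, (mem_torusInBorel_iff_torusPart_eq t).2 ht⟩

/-- **`χ⁻(a_t) · H(t) = H(1)` and `‖a_t‖ · H(t)² = H(1)²` for `torusPart t = t`** — the `χ⁻ ↔ H` conversion in the pen's letters.
[cite: Rogawski1990, §7.2 Prop. 7.2.2 (pp. 94–95)] -/
theorem traceZeroModulus_centralCharacter_mul_borelHeight_of_torusPart_eq (hc : c * c = 1) (hc1 : c ≠ 1)
    [MeasurableSpace (AdeleRing (𝓞 E) E)] [BorelSpace (AdeleRing (𝓞 E) E)] {t : borelAdelic F E c 3} (ht : torusPart t = t)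
    (hl : conjAdele F E c ((((diagUnit t.2 0)⁻¹ * diagUnit t.2 2 : (AdeleRing (𝓞 E) E)ˣ)) : AdeleRing (𝓞 E) E) =
      ((diagUnit t.2 0)⁻¹ * diagUnit t.2 2 : (AdeleRing (𝓞 E) E)ˣ)) :
    traceZeroModulus ((diagUnit t.2 0)⁻¹ * diagUnit t.2 2) hl * borelHeight (t : (quasiSplit F E c 3).Adelic) =
        borelHeight (1 : (quasiSplit F E c 3).Adelic) ∧
      IdeleClassGroup.ideleNorm E ((diagUnit t.2 0)⁻¹ * diagUnit t.2 2 : (AdeleRing (𝓞 E) E)ˣ) *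
          borelHeight (t : (quasiSplit F E c 3).Adelic) ^ 2 =
        borelHeight (1 : (quasiSplit F E c 3).Adelic) ^ 2 :=
  ⟨traceZeroModulus_centralCharacter_mul_borelHeight hc hc1 ⟨t, (mem_torusInBorel_iff_torusPart_eq t).2 ht⟩ hl,
    ideleNorm_centralCharacter_mul_borelHeight_sq ⟨t, (mem_torusInBorel_iff_torusPart_eq t).2 ht⟩⟩

end BorelLetters

end UnitaryGroup

end Literature.NumberTheory.Automorphic

end
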